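import Literature.Analysis.Calculus.ConePoincareHomotopy
import HarnessLib

/-!
# The cone primitive vanishes at its base point

A one-lemma complement to `ConePoincareHomotopy.lean`: `h ω (x₀) = conePrimitive x₀ ω x₀ = 0` — the
cone over the base point is degenerate.  (In the van Est / Čech–de Rham descent of a closed invariant
form this is what evaluates the bottom of the staircase: at the last vertex every iterated primitive
with that base point drops out.)  Theorems only. [cite: Spivak1965, Thm. 4-11]

## References

* M. Spivak, *Calculus on Manifolds* (1965), Thm. 4-11. [Spivak1965]
-/

noncomputable section

open Set MeasureTheory

namespace Literature.Analysis.Calculus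

variable {E F : Type*} [NormedAddCommGroup E] [NormedSpace ℝ E] [NormedAddCommGroup F] [NormedSpace ℝ F]
  {n : ℕ}

/-- The cone point over the base point is constant: `conePt x₀ x₀ t = x₀`. [folklore] -/
@[simp] theorem conePt_self (x₀ : E) (t : ℝ) : conePt x₀ x₀ t = x₀ := by
  simp [conePt]

/-- **`h ω` vanishes at the base point**: `conePrimitive x₀ ω x₀ = 0`. [cite: Spivak1965, Thm. 4-11] -/
@[simp] theorem conePrimitive_apply_base (x₀ : E) (ω : E → E [⋀^Fin (n + 1)]→L[ℝ] F) :
    conePrimitive x₀ ω x₀ = 0 := by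
  simp [conePrimitive]

/-- Hence also every component: `conePrimitive x₀ ω x₀ v = 0`. [folklore] -/
theorem conePrimitive_apply_base_apply (x₀ : E) (ω : E → E [⋀^Fin (n + 1)]→L[ℝ] F) (v : Fin n → E) :
    conePrimitive x₀ ω x₀ v = 0 := by
  rw [conePrimitive_apply_base]
  rfl

end Literature.Analysis.Calculus

end
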